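/-
Copyright: statement-level skeleton of a published paper (lit-balaban cell, Phase-2 proof seat p32 gen 42). No claims beyond
what the kernel checks below.
-/
import Literature.MathematicalPhysics.QuantumFieldTheory.Balaban1983to89.B3OnePIChainDecomposition

/-!
# B3 — T. Bałaban, *(Higgs)₂,₃ quantum fields in a finite volume. III. Renormalization*, CMP **88** (1983) 411–445
[Balaban1983Higgs3] — p. 416 [PDF 6] (1.21): THE CHAIN DECOMPOSITION OF A CONNECTED TWO-ROOTED GRAPH OF THE MODEL, II —
the PIECES `V_k = {level = k}` are connected through their own lines and PROPER between their ports (no single line of a piece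
separates its entry from its exit): «connected two-point graph = chain `V_0 —ℓ₁— V_1 —ℓ₂— ⋯ —ℓ_m— V_m` of proper insertions joined
by single propagator lines», derived on p18's `B3Cor23Concrete.Graph`

statement-level skeleton of published theorems with citation tags; proofs where landed; nothing here is a claim about
the Yang–Mills mass gap

PDF held: `paper:balaban1983-higgs-2-3-quantum-fields-finite-volume` (journal page = PDF page + 410); p. 415 L28–31, p. 416 L13–18
re-read this session (text layer `p0005.txt`/`p0006.txt`; ×2 renders `…/1983-cmp88-higgs23-III-p005, p006-x2.png`).

CITATION HEADER (lean-in-tree rule).  lit-balaban TYPED SKELETON (HOME `run/shared/lean/pub/lit-balaban/`), PHASE 2, seat p32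
gen 42 (unit `lit-balaban-p32`; TAKING line HOME/STATUS.md 2026-08-23T10:20:40Z), row **B3.Eq1.19-1.22** of
`HOME/lit-balaban-r15/ROWS-B3.md` (fold owner r15, referee ref-4; head `proved` under the lead g12 HEAD WORD Q25, reading (P); this
file is an OPTIONAL located member of the (1.21) cell, zero head weight).  Sibling and continuation of `B3OnePIChainDecomposition`
(same seat: `Sep`, `IsNear`, `numSep`, `level`, `level_far`, `level_eq_of_not_sep`, `IsNear.eq_of_level_eq`,
`exists_isNear_level_eq`); built on p37 g105's `B3OnePIGraphs`/`B3OnePIBridge`/`B3OnePIBridgeOrder` BY NAME; the graph side of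
p32 g41's BRICK 2 `B3Eq121OnePIChains` (chains `C₀K₁C₀…K_mC₀`).  Nothing re-declared.

THE PRINTED TEXT (verbatim).  p. 416: *"The function G^ε has a perturbative expansion of the following structure
G^ε = Σ_{n=0}^∞ C₀^ε[(−δm² + Σ^ε + ∂^{ε*}Σ₁^ε + Σ₁^{ε*}∂^ε + ∂^{ε*}Σ₂^ε∂^ε)C₀^ε]ⁿ, (1.21) where C₀^ε = (−Δ₀^ε + m²)^{−1} and Σ^ε, Σ₁^ε, Σ₂^ε
are given by amputated, one-particle-irreducible graphs of the expansion of G^ε."*  (Stated without proof in print; the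
textbook structure behind it is what the two files prove for the model's graphs.)

WHAT IS PROVED (theorems only; no definition, no `Prop` fact, no `sorry`; standard axioms).  Roots `i j : Fin G.nV`,
`m = numSep G i j`, pieces `V_k = {v | level G i j v = k}`; the PORTS of `V_k`: entry = `i` (k = 0) or the far endpoint of the k-th
separating line, exit = `j` (k = m) or the near endpoint of the (k+1)-th separating line.
* §1 generic walk lemmas for `Relation.ReflTransGen r` against a function `f : α → ℕ`: `exists_first_exit` (first step leaving
  `{f = k}`), `exists_first_up` / `exists_first_down` (first step `k → k+1` / `k+1 → k` when `f` moves by ≤ 1 per step),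
  `reflTransGen_of_imp`, `reflTransGen_reverse`, `restrict_symm`;
* §2 adjacency inside a piece is written out as `fun a b => Adj G a b ∧ level a = k ∧ level b = k` (`adjLevel_symm`); `not_sep_of_level_eq`, `reflTransGen_adjOff_of_not_sep` (cutting a
  leg on no separating line keeps the roots joined);
* §3 PORT WALKS along any symmetric sub-relation `r ≤ Adj G` joining `i` to `j`: **`port_zero`**, **`port_succ`**, **`port_last`**,
  `port_none` — the two ports of `V_k` are joined by an `r`-walk INSIDE `V_k` (first ascent of the walk `i → j` above `k`, then first
  descent of the reversed prefix below `k`; the crossings are identified by `IsNear.eq_of_level_eq`);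
* §4 **`pieces_connected`**: two vertices of equal level `k` are joined by a walk of `G` all of whose vertices have level `k` (via
  `reach_exit` / `reach_entry_last`: every vertex of `V_k` is joined inside `V_k` to a port); `adjOff_of_adjLevel` (such walks avoid
  every separating line);
* §5 PROPERNESS: **`proper_succ`** / `proper_zero` / `proper_last` / `proper_none` — after cutting ANY leg on no separating line
  (in particular any line inside a piece) the ports of `V_k` are still joined inside `V_k` (§3 with `r = AdjOff G x`);
* §6 READING FROM THE OTHER ROOT: `sep_comm`, `isNear_swap` (far legs from `i` = near legs from `j`), **`numSep_comm`**,
  **`level_add_level_swap`** (`level G i j v + level G j i v = m`: the pieces are intrinsic, `V_k` from `i` = `V_{m−k}` from `j`);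
* §7 `numSep_eq_zero_iff`, `numSep_eq_zero_of_isOnePI`, **`isProper_iff_numSep_eq_zero`** (p37's `IsProper G` ⇔ connected and `m = 0` for every pair of external
  legs: a proper insertion is a one-piece chain), and the packaged statement **`chain_decomposition`**.
HONEST SCOPE.  As in the sibling: vertex-level statements; no sub-graph objects, no gluing inverse, no amplitude map; "proper"
is the two-port (channel) notion of `B3OnePIGraphs.IsProper`, weaker than `IsOnePI` (a piece may carry a part hanging by one line
off the channel, cf. `B3OnePIPictureCensus.isProper_g321Y`); nothing analytic.
-/

namespace Literature.MathematicalPhysics.QuantumFieldTheory.Balaban1983to89.B3OnePIChainPieces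

open Relation Finset B3Prop1 B3Cor23Concrete B3OnePIGraphs B3OnePIBridge B3OnePIBridgeOrder B3OnePIChainDecomposition

/-! ## §1 Walks against a level function: first exit, first ascent, first descent (generic) -/

section Walks

variable {α : Type*} {r : α → α → Prop} {f : α → ℕ}

/-- kernel (first exit from a level set): a walk from `a` with `f a = k` to `b` with `f b ≠ k` runs inside `{f = k}` up to a
first step leaving it. [cite: Balaban1983Higgs3, (1.21) p.416] -/
theorem exists_first_exit {a b : α} (h : ReflTransGen r a b) {k : ℕ} (hb : f b ≠ k) :
    f a = k → ∃ p q, ReflTransGen (fun x y => r x y ∧ f x = k ∧ f y = k) a p ∧ r p q ∧ f p = k ∧ f q ≠ k := by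
  induction h using ReflTransGen.head_induction_on with
  | refl => exact fun ha => absurd ha hb
  | @head a c hac _ ih =>
      intro ha
      by_cases hc : f c = k
      · obtain ⟨p, q, hw, hpq, hp, hq⟩ := ih hc
        exact ⟨p, q, ReflTransGen.head ⟨hac, ha, hc⟩ hw, hpq, hp, hq⟩
      · exact ⟨a, c, ReflTransGen.refl, hac, ha, hc⟩

/-- kernel (first ascent): if `f` grows by at most one along steps, a walk from `{f ≤ k}` to `{f > k}` runs inside `{f ≤ k}` up
to a first step from level `k` to level `k + 1`. [cite: Balaban1983Higgs3, (1.21) p.416] -/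
theorem exists_first_up (hstep : ∀ x y, r x y → f y ≤ f x + 1) {a b : α} (h : ReflTransGen r a b) {k : ℕ} (hb : k < f b) :
    f a ≤ k → ∃ p q, ReflTransGen (fun x y => r x y ∧ f x ≤ k ∧ f y ≤ k) a p ∧ r p q ∧ f p = k ∧ f q = k + 1 := by
  induction h using ReflTransGen.head_induction_on with
  | refl => intro ha; omega
  | @head a c hac _ ih =>
      intro ha
      by_cases hc : f c ≤ k
      · obtain ⟨p, q, hw, hpq, hp, hq⟩ := ih hc
        exact ⟨p, q, ReflTransGen.head ⟨hac, ha, hc⟩ hw, hpq, hp, hq⟩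
      · have := hstep _ _ hac
        exact ⟨a, c, ReflTransGen.refl, hac, by omega, by omega⟩

/-- kernel (first descent): if `f` drops by at most one along steps, a walk from `{f ≥ k + 1}` to `{f ≤ k}` runs inside
`{f ≥ k + 1}` up to a first step from level `k + 1` to level `k`. [cite: Balaban1983Higgs3, (1.21) p.416] -/
theorem exists_first_down (hstep : ∀ x y, r x y → f x ≤ f y + 1) {a b : α} (h : ReflTransGen r a b) {k : ℕ} (hb : f b ≤ k) :
    k + 1 ≤ f a →
      ∃ p q, ReflTransGen (fun x y => r x y ∧ k + 1 ≤ f x ∧ k + 1 ≤ f y) a p ∧ r p q ∧ f p = k + 1 ∧ f q = k := by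
  induction h using ReflTransGen.head_induction_on with
  | refl => intro ha; omega
  | @head a c hac _ ih =>
      intro ha
      by_cases hc : k + 1 ≤ f c
      · obtain ⟨p, q, hw, hpq, hp, hq⟩ := ih hc
        exact ⟨p, q, ReflTransGen.head ⟨hac, ha, hc⟩ hw, hpq, hp, hq⟩
      · have := hstep _ _ hac
        exact ⟨a, c, ReflTransGen.refl, hac, by omega, by omega⟩

/-- kernel: a walk along `r` is a walk along any weaker relation. [cite: Balaban1983Higgs3, (1.21) p.416] -/
theorem reflTransGen_of_imp {p : α → α → Prop} (H : ∀ x y, r x y → p x y) {a b : α} (h : ReflTransGen r a b) :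
    ReflTransGen p a b := by
  induction h with
  | refl => exact ReflTransGen.refl
  | tail _ hbc ih => exact ih.tail (H _ _ hbc)

/-- kernel: walks along a symmetric relation can be reversed. [cite: Balaban1983Higgs3, (1.21) p.416] -/
theorem reflTransGen_reverse (hs : ∀ x y, r x y → r y x) {a b : α} (h : ReflTransGen r a b) : ReflTransGen r b a := by
  induction h with
  | refl => exact ReflTransGen.refl
  | tail _ hbc ih => exact ReflTransGen.head (hs _ _ hbc) ih

/-- kernel: restricting a symmetric relation to a set of vertices (both ends) keeps it symmetric.
[cite: Balaban1983Higgs3, (1.21) p.416] -/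
theorem restrict_symm {P : α → Prop} (hs : ∀ x y, r x y → r y x) :
    ∀ x y, (r x y ∧ P x ∧ P y) → (r y x ∧ P y ∧ P x) :=
  fun _ _ h => ⟨hs _ _ h.1, h.2.2, h.2.1⟩

end Walks

variable {nbar : ℕ} {G : Graph nbar} {i j : Fin G.nV}

/-! ## §2 Adjacency inside a piece -/

section Model

/-- kernel: adjacency INSIDE the piece `V_k` — `fun a b => Adj G a b ∧ level G i j a = k ∧ level G i j b = k`, written out in
every statement below (no new definition) — is symmetric. [cite: Balaban1983Higgs3, (1.21) p.416] -/
theorem adjLevel_symm {k : ℕ} {a b : Fin G.nV} (h : Adj G a b ∧ level G i j a = k ∧ level G i j b = k) :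
    Adj G b a ∧ level G i j b = k ∧ level G i j a = k :=
  ⟨adj_symm h.1, h.2.2, h.2.1⟩

/-- kernel: a line both of whose endpoints have the same level does not separate `i` from `j` (a separating line changes
the level by one). [cite: Balaban1983Higgs3, (1.21) p.416] -/
theorem not_sep_of_level_eq (hG : IsConnected G) {x y : Leg G.kind} (hxy : G.other x = some y)
    (h : level G i j x.1 = level G i j y.1) : ¬ Sep G i j x := by
  intro hx
  rcases hx.level_cases hG hxy with ⟨_, e⟩ | ⟨_, e⟩ <;> omega

/-- kernel: for a leg `x` on NO separating line (an external leg, or a leg of a non-separating internal line), the roots stay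
joined after cutting at `x`. [cite: Balaban1983Higgs3, (1.21) p.416] -/
theorem reflTransGen_adjOff_of_not_sep (hG : IsConnected G) {x : Leg G.kind} (hx : ¬ Sep G i j x) :
    ReflTransGen (AdjOff G x) i j := by
  by_cases hxs : (G.other x).isSome
  · by_contra h
    exact hx ⟨hxs, h⟩
  · -- `x` is external: cutting at `x` removes nothing
    refine reflTransGen_of_imp (fun a b hab => ?_) (hG i j)
    obtain ⟨x', y', h', rfl, rfl⟩ := adj_iff.1 hab
    refine adjOffOf_iff.2 ⟨x', y', h', ?_, ?_, rfl, rfl⟩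
    · rintro rfl
      exact hxs (by simp [h'])
    · rintro rfl
      exact hxs (by simp [G.other_symm _ _ h'])

end Model

/-! ## §3 The ports of a piece are joined inside the piece, even after cutting a non-separating line -/

section Ports

variable (hG : IsConnected G) {r : Fin G.nV → Fin G.nV → Prop} (hr : ∀ a b, r a b → Adj G a b)
  (hrs : ∀ a b, r a b → r b a) (hij : ReflTransGen r i j)
include hG hr hrs hij

omit hrs in
/-- **piece `V_0`, from the root**: along any symmetric sub-relation `r` of adjacency joining `i` to `j` (all of `Adj G`; or
`AdjOff G x` for a non-separating `x`), the root `i` is joined INSIDE `V_0` to the near endpoint of the first separating line.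
[cite: Balaban1983Higgs3, (1.21) p.416] -/
theorem port_zero {d : Leg G.kind} (hd : IsNear G i j d) (h0 : level G i j d.1 = 0) :
    ReflTransGen (fun a b => r a b ∧ level G i j a = 0 ∧ level G i j b = 0) i d.1 := by
  have hup : ∀ x y, r x y → level G i j y ≤ level G i j x + 1 := fun x y h => level_le_succ_of_adj hG (hr x y h)
  have hm : 0 < level G i j j := by rw [level_right]; exact h0 ▸ hd.level_lt
  obtain ⟨p, q, hw, hpq, hp, hq⟩ := exists_first_up hup hij hm (le_of_eq level_left)
  obtain ⟨x, y, hxy, hx, rfl, rfl⟩ := exists_isNear_of_adj_succ (i := i) (j := j) hG (hr _ _ hpq) (by omega)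
  have hxd : x = d := hx.eq_of_level_eq hG hd (by omega)
  subst hxd
  exact reflTransGen_of_imp (fun a b h => ⟨h.1, Nat.le_zero.1 h.2.1, Nat.le_zero.1 h.2.2⟩) hw

/-- **piece `V_k`, `0 < k < m`, between its ports**: the far endpoint of the `k`-th separating line (near leg `c` at level
`k − 1`, far leg `c′`) is joined INSIDE `V_k` to the near endpoint of the `(k+1)`-th separating line (near leg `d` at level `k`),
along any symmetric sub-relation `r` of adjacency joining `i` to `j`. [cite: Balaban1983Higgs3, (1.21) p.416] -/
theorem port_succ {c c' d : Leg G.kind} (hc : IsNear G i j c) (hc' : G.other c = some c') (hd : IsNear G i j d)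
    (hk : level G i j d.1 = level G i j c.1 + 1) :
    ReflTransGen (fun a b => r a b ∧ level G i j a = level G i j d.1 ∧ level G i j b = level G i j d.1) c'.1 d.1 := by
  have hup : ∀ x y, r x y → level G i j y ≤ level G i j x + 1 := fun x y h => level_le_succ_of_adj hG (hr x y h)
  have hdown : ∀ x y, r x y → level G i j x ≤ level G i j y + 1 := fun x y h =>
    level_le_succ_of_adj hG (adj_symm (hr x y h))
  set k₀ := level G i j c.1 with hk₀
  -- first ascent of the walk `i → j` above level `k₀ + 1`: it happens at `d.1`
  have hm : k₀ + 1 < level G i j j := by rw [level_right]; exact hk ▸ hd.level_lt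
  obtain ⟨p, q, hw, hpq, hp, hq⟩ := exists_first_up hup hij hm (by rw [level_left]; omega)
  obtain ⟨x, y, hxy, hx, rfl, rfl⟩ := exists_isNear_of_adj_succ (i := i) (j := j) hG (hr _ _ hpq) (by omega)
  have hxd : x = d := hx.eq_of_level_eq hG hd (by omega)
  subst hxd
  -- walk it back from `d.1` towards `i` inside `{level ≤ k₀ + 1}`: its first descent below `k₀ + 1` happens along ℓ_k, at `c′.1`
  have hw' := reflTransGen_reverse (restrict_symm (P := fun v => level G i j v ≤ k₀ + 1) hrs) hw
  have hdown' : ∀ a b, (r a b ∧ level G i j a ≤ k₀ + 1 ∧ level G i j b ≤ k₀ + 1) → level G i j a ≤ level G i j b + 1 :=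
    fun a b h => hdown a b h.1
  obtain ⟨p', q', hw₂, hpq', hp', hq'⟩ :=
    exists_first_down hdown' hw' (k := k₀) (by rw [level_left]; omega) (by omega)
  -- the descending step q′ ← p′ is the crossing of ℓ_k: p′ = c′.1
  obtain ⟨x', y', hxy', hx', rfl, rfl⟩ :=
    exists_isNear_of_adj_succ (i := i) (j := j) hG (adj_symm (hr _ _ hpq'.1)) (by omega)
  have hxc : x' = c := hx'.eq_of_level_eq hG hc (by omega)
  subst hxc
  have hyc : y' = c' := by rw [hc'] at hxy'; exact (Option.some.inj hxy').symm
  subst hyc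
  -- the walk `d.1 → c′.1` lies in `{level ≤ k₀+1} ∩ {level ≥ k₀+1} = V_{k₀+1}`; reverse it
  have hw₃ : ReflTransGen (fun a b => r a b ∧ level G i j a = k₀ + 1 ∧ level G i j b = k₀ + 1) x.1 y'.1 :=
    reflTransGen_of_imp (fun a b h => ⟨h.1.1, by omega, by omega⟩) hw₂
  rw [hk]
  exact reflTransGen_reverse (restrict_symm (P := fun v => level G i j v = k₀ + 1) hrs) hw₃

/-- **piece `V_m`, to the root** (`m > 0`): the far endpoint of the last separating line (near leg `c` at level `m − 1`) is
joined INSIDE `V_m` to the root `j`, along any symmetric sub-relation `r` of adjacency joining `i` to `j`.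
[cite: Balaban1983Higgs3, (1.21) p.416] -/
theorem port_last {c c' : Leg G.kind} (hc : IsNear G i j c) (hc' : G.other c = some c')
    (hm : level G i j c.1 + 1 = numSep G i j) :
    ReflTransGen (fun a b => r a b ∧ level G i j a = numSep G i j ∧ level G i j b = numSep G i j) c'.1 j := by
  have hdown : ∀ x y, r x y → level G i j x ≤ level G i j y + 1 := fun x y h =>
    level_le_succ_of_adj hG (adj_symm (hr x y h))
  have hji := reflTransGen_reverse hrs hij
  obtain ⟨p', q', hw, hpq', hp', hq'⟩ :=
    exists_first_down hdown hji (k := level G i j c.1) (by rw [level_left]; omega) (by rw [level_right]; omega)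
  obtain ⟨x', y', hxy', hx', rfl, rfl⟩ :=
    exists_isNear_of_adj_succ (i := i) (j := j) hG (adj_symm (hr _ _ hpq')) (by omega)
  have hxc : x' = c := hx'.eq_of_level_eq hG hc (by omega)
  subst hxc
  have hyc : y' = c' := by rw [hc'] at hxy'; exact (Option.some.inj hxy').symm
  subst hyc
  have hw₃ : ReflTransGen (fun a b => r a b ∧ level G i j a = numSep G i j ∧ level G i j b = numSep G i j) j y'.1 :=
    reflTransGen_of_imp (fun a b h => ⟨h.1, by have := level_le (i := i) (j := j) a; omega,
      by have := level_le (i := i) (j := j) b; omega⟩) hw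
  exact reflTransGen_reverse (restrict_symm (P := fun v => level G i j v = numSep G i j) hrs) hw₃

omit hG hr hrs in
/-- **no separating line** (`m = 0`): the whole graph is one piece `V_0` and `i` is joined to `j` inside it along `r`.
[cite: Balaban1983Higgs3, (1.21) p.416] -/
theorem port_none (hm : numSep G i j = 0) :
    ReflTransGen (fun a b => r a b ∧ level G i j a = 0 ∧ level G i j b = 0) i j :=
  reflTransGen_of_imp (fun a b h => ⟨h, by have := level_le (i := i) (j := j) a; omega,
    by have := level_le (i := i) (j := j) b; omega⟩) hij

end Ports

/-! ## §4 The pieces `V_k` are connected through their own lines -/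

section Pieces

variable (hG : IsConnected G)
include hG

/-- kernel: every vertex of the piece `V_k`, `k < m`, is joined INSIDE `V_k` to the exit port of `V_k` (the near endpoint of
the `(k+1)`-th separating line). [cite: Balaban1983Higgs3, (1.21) p.416] -/
theorem reach_exit {w : Fin G.nV} {d : Leg G.kind} (hd : IsNear G i j d) (hw : level G i j w = level G i j d.1) :
    ReflTransGen (fun a b => Adj G a b ∧ level G i j a = level G i j d.1 ∧ level G i j b = level G i j d.1) w d.1 := by
  have hadj : ∀ a b : Fin G.nV, Adj G a b → Adj G a b := fun _ _ h => h
  have hsym : ∀ a b : Fin G.nV, Adj G a b → Adj G b a := fun _ _ h => adj_symm h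
  set k := level G i j d.1 with hk
  -- first exit from `V_k` along a walk `w → j`
  have hjk : level G i j j ≠ k := by rw [level_right]; exact (hk ▸ hd.level_lt).ne'
  obtain ⟨p, q, hwp, hpq, hp, hq⟩ := exists_first_exit (f := level G i j) (hG w j) hjk hw
  rcases level_adj (i := i) (j := j) hG hpq with e | e | e
  · exact absurd (e.symm.trans hp) hq
  · -- exit upwards: `p` is the near endpoint of ℓ_{k+1}, i.e. `p = d.1`
    obtain ⟨x, y, _, hx, rfl, rfl⟩ := exists_isNear_of_adj_succ (i := i) (j := j) hG hpq e
    have hxd : x = d := hx.eq_of_level_eq hG hd (by omega)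
    subst hxd
    exact hwp
  · -- exit downwards (`k > 0`): `p` is the far endpoint of ℓ_k; the ports of `V_k` are joined inside `V_k`
    obtain ⟨x, y, hxy, hx, rfl, rfl⟩ := exists_isNear_of_adj_succ (i := i) (j := j) hG (adj_symm hpq) e
    have hport := port_succ hG hadj hsym (hG i j) hx hxy hd (by omega)
    exact hwp.trans (hk ▸ hport)

/-- kernel: every vertex of the last piece `V_m`, `m > 0`, is joined INSIDE `V_m` to its entry port (the far endpoint of the
`m`-th separating line). [cite: Balaban1983Higgs3, (1.21) p.416] -/
theorem reach_entry_last {w : Fin G.nV} {c c' : Leg G.kind} (hc : IsNear G i j c) (hc' : G.other c = some c')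
    (hm : level G i j c.1 + 1 = numSep G i j) (hw : level G i j w = numSep G i j) :
    ReflTransGen (fun a b => Adj G a b ∧ level G i j a = numSep G i j ∧ level G i j b = numSep G i j) w c'.1 := by
  have hik : level G i j i ≠ numSep G i j := by rw [level_left]; omega
  obtain ⟨p, q, hwp, hpq, hp, hq⟩ := exists_first_exit (f := level G i j) (hG w i) hik hw
  rcases level_adj (i := i) (j := j) hG hpq with e | e | e
  · exact absurd (e.symm.trans hp) hq
  · have := level_le (i := i) (j := j) q
    omega
  · obtain ⟨x, y, hxy, hx, rfl, rfl⟩ := exists_isNear_of_adj_succ (i := i) (j := j) hG (adj_symm hpq) e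
    have hxc : x = c := hx.eq_of_level_eq hG hc (by omega)
    subst hxc
    have hyc : y = c' := by rw [hc'] at hxy; exact (Option.some.inj hxy).symm
    subst hyc
    exact hwp

/-- **THE PIECES ARE CONNECTED**: two vertices of the same level `k` are joined by a path of internal lines all of whose
vertices have level `k` — every piece `V_k` of the chain is connected through its own (non-separating) lines.
[cite: Balaban1983Higgs3, (1.21) p.416] -/
theorem pieces_connected {u v : Fin G.nV} (h : level G i j u = level G i j v) :
    ReflTransGen (fun a b => Adj G a b ∧ level G i j a = level G i j u ∧ level G i j b = level G i j u) u v := by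
  rcases Nat.lt_or_ge (level G i j u) (numSep G i j) with hk | hk
  · -- `k < m`: both are joined to the exit port of `V_k`
    obtain ⟨d, hd, hdk⟩ := exists_isNear_level_eq hG hk
    have hu := reach_exit hG hd hdk.symm
    have hv := reach_exit hG hd (h.symm.trans hdk.symm)
    rw [hdk] at hu hv
    exact hu.trans (reflTransGen_reverse (fun _ _ h => adjLevel_symm h) hv)
  · have hum : level G i j u = numSep G i j := le_antisymm (level_le u) hk
    rcases Nat.eq_zero_or_pos (numSep G i j) with hm | hm
    · -- `m = 0`: one piece, every line is inside it
      rw [hum, hm]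
      exact reflTransGen_of_imp (fun a b hab => ⟨hab, by have := level_le (i := i) (j := j) a; omega,
        by have := level_le (i := i) (j := j) b; omega⟩) (hG u v)
    · -- `k = m > 0`: both are joined to the entry port of `V_m`
      obtain ⟨c, hc, hck⟩ := exists_isNear_level_eq (i := i) (j := j) hG (k := numSep G i j - 1) (by omega)
      obtain ⟨c', hc'⟩ := hc.1.exists_other
      have hm' : level G i j c.1 + 1 = numSep G i j := by omega
      have hu := reach_entry_last hG hc hc' hm' hum
      have hv := reach_entry_last hG hc hc' hm' (h.symm.trans hum)
      rw [hum]
      exact hu.trans (reflTransGen_reverse (fun _ _ h => adjLevel_symm h) hv)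

/-- kernel: a path inside a piece uses only non-separating lines — read a `V_k`-path as a path of `G` avoiding the cut of ANY
separating line. [cite: Balaban1983Higgs3, (1.21) p.416] -/
theorem adjOff_of_adjLevel {k : ℕ} {a b : Fin G.nV} (h : Adj G a b ∧ level G i j a = k ∧ level G i j b = k)
    {c : Leg G.kind} (hc : Sep G i j c) :
    AdjOff G c a b := by
  obtain ⟨x, y, hxy, rfl, rfl⟩ := adj_iff.1 h.1
  have hx : ¬ Sep G i j x := not_sep_of_level_eq hG hxy (h.2.1.trans h.2.2.symm)
  refine adjOffOf_iff.2 ⟨x, y, hxy, ?_, ?_, rfl, rfl⟩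
  · rintro rfl
    exact hx hc
  · rintro rfl
    exact hx (hc.of_other (G.other_symm _ _ hxy))

end Pieces

/-! ## §5 The pieces are PROPER between their ports -/

section Proper

variable (hG : IsConnected G)
include hG

/-- **PROPERNESS of the inner pieces**: cut any leg `x` on no separating line (in particular any internal line INSIDE a
piece); then the entry port of `V_k` (far endpoint of ℓ_k) is still joined to its exit port (near endpoint of ℓ_{k+1}) INSIDE
`V_k`, `0 < k < m` — no single line of the piece separates its two ports: the piece is a proper (channel-irreducible) insertion.
[cite: Balaban1983Higgs3, (1.21) p.416] -/
theorem proper_succ {x : Leg G.kind} (hx : ¬ Sep G i j x) {c c' d : Leg G.kind} (hc : IsNear G i j c)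
    (hc' : G.other c = some c') (hd : IsNear G i j d) (hk : level G i j d.1 = level G i j c.1 + 1) :
    ReflTransGen (fun a b => AdjOff G x a b ∧ level G i j a = level G i j d.1 ∧ level G i j b = level G i j d.1)
      c'.1 d.1 :=
  port_succ hG (fun _ _ h => h.adj) (fun _ _ h => adjOff_symm h) (reflTransGen_adjOff_of_not_sep hG hx) hc hc' hd hk

/-- **PROPERNESS of the first piece** (`m > 0`): after cutting any leg on no separating line, the root `i` is still joined
INSIDE `V_0` to the exit port of `V_0`. [cite: Balaban1983Higgs3, (1.21) p.416] -/
theorem proper_zero {x : Leg G.kind} (hx : ¬ Sep G i j x) {d : Leg G.kind} (hd : IsNear G i j d)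
    (h0 : level G i j d.1 = 0) :
    ReflTransGen (fun a b => AdjOff G x a b ∧ level G i j a = 0 ∧ level G i j b = 0) i d.1 :=
  port_zero hG (fun _ _ h => h.adj) (reflTransGen_adjOff_of_not_sep hG hx) hd h0

/-- **PROPERNESS of the last piece** (`m > 0`): after cutting any leg on no separating line, the entry port of `V_m` is still
joined INSIDE `V_m` to the root `j`. [cite: Balaban1983Higgs3, (1.21) p.416] -/
theorem proper_last {x : Leg G.kind} (hx : ¬ Sep G i j x) {c c' : Leg G.kind} (hc : IsNear G i j c)
    (hc' : G.other c = some c') (hm : level G i j c.1 + 1 = numSep G i j) :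
    ReflTransGen (fun a b => AdjOff G x a b ∧ level G i j a = numSep G i j ∧ level G i j b = numSep G i j) c'.1 j :=
  port_last hG (fun _ _ h => h.adj) (fun _ _ h => adjOff_symm h) (reflTransGen_adjOff_of_not_sep hG hx) hc hc' hm

/-- **PROPERNESS when nothing separates** (`m = 0`): after cutting any leg on no separating line — here: ANY leg — the
roots are still joined (inside the single piece `V_0` = all vertices). [cite: Balaban1983Higgs3, (1.21) p.416] -/
theorem proper_none {x : Leg G.kind} (hx : ¬ Sep G i j x) (hm : numSep G i j = 0) :
    ReflTransGen (fun a b => AdjOff G x a b ∧ level G i j a = 0 ∧ level G i j b = 0) i j :=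
  port_none (reflTransGen_adjOff_of_not_sep hG hx) hm

end Proper

/-! ## §6 Reading the chain from the other root -/

/-- kernel: separation is symmetric in the two roots. [cite: Balaban1983Higgs3, (1.21) p.416] -/
theorem sep_comm {c : Leg G.kind} : Sep G i j c ↔ Sep G j i c :=
  ⟨fun h => ⟨h.1, fun h' => h.2 (reflTransGen_adjOff_symm h')⟩, fun h => ⟨h.1, fun h' => h.2 (reflTransGen_adjOff_symm h')⟩⟩

section Swap

variable (hG : IsConnected G)
include hG

/-- kernel: the far leg of a near leg (seen from `i`) is a near leg seen from `j`. [cite: Balaban1983Higgs3, (1.21) p.416] -/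
theorem isNear_swap {c c' : Leg G.kind} (h : IsNear G i j c) (hc : G.other c = some c') : IsNear G j i c' := by
  refine ⟨sep_comm.1 (h.1.of_other hc), ?_⟩
  rw [adjOff_other_eq hc]
  exact reflTransGen_adjOff_symm (h.far hG hc).2

/-- kernel: a vertex lies beyond a separating line seen from `i` iff it does NOT lie beyond it seen from `j` (the cut leaves
exactly two sides, `B3OnePIBridge.side_total`). [cite: Balaban1983Higgs3, (1.21) p.416] -/
theorem beyond_iff_not_beyond_swap {c c' : Leg G.kind} (h : IsNear G i j c) (hc : G.other c = some c') (v : Fin G.nV) :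
    ¬ ReflTransGen (AdjOff G c) i v ↔ ReflTransGen (AdjOff G c') j v := by
  rw [adjOff_other_eq hc]
  constructor
  · intro hv
    rcases side_total hG hc h.1.2 v with h₁ | h₂
    · exact absurd h₁ hv
    · exact reflTransGen_adjOff_symm h₂
  · intro hjv hiv
    exact h.1.2 (hiv.trans (reflTransGen_adjOff_symm hjv))

/-- **the number of separating lines does not depend on the direction of reading**: `numSep G i j = numSep G j i` (the near legs
seen from `j` are the far legs seen from `i`). [cite: Balaban1983Higgs3, (1.21) p.416] -/
theorem numSep_comm : numSep G i j = numSep G j i := by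
  classical
  -- the map near leg ↦ its other leg, in both directions
  have key : ∀ {i j : Fin G.nV}, (nearLegs G i j).card ≤ (nearLegs G j i).card := by
    intro i j
    refine card_le_card_of_injOn (fun c => (G.other c).elim c id) (fun c hc => ?_) (fun c hc d hd hcd => ?_)
    · obtain ⟨c', hc'⟩ := (mem_nearLegs.1 hc).1.exists_other
      simp only [hc', Option.elim_some, id, mem_coe]
      exact mem_nearLegs.2 (isNear_swap hG (mem_nearLegs.1 hc) hc')
    · obtain ⟨c', hc'⟩ := (mem_nearLegs.1 (mem_coe.1 hc)).1.exists_other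
      obtain ⟨d', hd'⟩ := (mem_nearLegs.1 (mem_coe.1 hd)).1.exists_other
      simp only [hc', hd', Option.elim_some, id] at hcd
      subst hcd
      have := G.other_symm _ _ hd'
      rw [G.other_symm _ _ hc'] at this
      exact Option.some.inj this
  exact le_antisymm key key

/-- **the level read from `j` is the mirror of the level read from `i`**: `level G i j v + level G j i v = m` — the pieces
`V_k` seen from `i` are the pieces `V_{m−k}` seen from `j`; the decomposition is intrinsic to the two-rooted graph.
[cite: Balaban1983Higgs3, (1.21) p.416] -/
theorem level_add_level_swap (v : Fin G.nV) : level G i j v + level G j i v = numSep G i j := by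
  classical
  -- `beyond G j i v` is the image under `other` of the near legs (from `i`) that `v` is NOT beyond
  set S := (nearLegs G i j).filter fun c => ReflTransGen (AdjOff G c) i v with hS
  have hsplit : (beyond G i j v).card + S.card = numSep G i j := by
    rw [numSep, beyond, hS]
    convert card_filter_add_card_filter_not (s := nearLegs G i j) (fun c => ¬ ReflTransGen (AdjOff G c) i v) using 3
    ext c
    simp
  have himg : S.card = (beyond G j i v).card := by
    apply le_antisymm
    · refine card_le_card_of_injOn (fun c => (G.other c).elim c id) (fun c hc => ?_) (fun c hc d hd hcd => ?_)
      · obtain ⟨hcn, hcv⟩ := mem_filter.1 (mem_coe.1 hc)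
        have hn := mem_nearLegs.1 hcn
        obtain ⟨c', hc'⟩ := hn.1.exists_other
        simp only [hc', Option.elim_some, id, mem_coe]
        refine mem_beyond.2 ⟨isNear_swap hG hn hc', fun h => ?_⟩
        exact ((beyond_iff_not_beyond_swap hG hn hc' v).2 h) hcv
      · obtain ⟨c', hc'⟩ := (mem_nearLegs.1 (mem_filter.1 (mem_coe.1 hc)).1).1.exists_other
        obtain ⟨d', hd'⟩ := (mem_nearLegs.1 (mem_filter.1 (mem_coe.1 hd)).1).1.exists_other
        simp only [hc', hd', Option.elim_some, id] at hcd
        subst hcd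
        have := G.other_symm _ _ hd'
        rw [G.other_symm _ _ hc'] at this
        exact Option.some.inj this
    · refine card_le_card_of_injOn (fun c => (G.other c).elim c id) (fun c' hc' => ?_) (fun c hc d hd hcd => ?_)
      · obtain ⟨hn', hv'⟩ := mem_beyond.1 (mem_coe.1 hc')
        obtain ⟨c, hc⟩ := hn'.1.exists_other
        have hn : IsNear G i j c := isNear_swap hG hn' hc
        simp only [hc, Option.elim_some, id, mem_coe, hS]
        refine mem_filter.2 ⟨mem_nearLegs.2 hn, ?_⟩
        by_contra hcv
        have hcc : G.other c = some c' := G.other_symm _ _ hc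
        exact hv' ((beyond_iff_not_beyond_swap hG hn hcc v).1 hcv)
      · obtain ⟨c', hc'⟩ := (mem_beyond.1 (mem_coe.1 hc)).1.1.exists_other
        obtain ⟨d', hd'⟩ := (mem_beyond.1 (mem_coe.1 hd)).1.1.exists_other
        simp only [hc', hd', Option.elim_some, id] at hcd
        subst hcd
        have := G.other_symm _ _ hd'
        rw [G.other_symm _ _ hc'] at this
        exact Option.some.inj this
  rw [level, level, ← himg]
  exact hsplit

end Swap

/-! ## §7 `m = 0` is p37's channel-properness; summary -/

/-- **no separating line ⇔ no internal line separates the roots**. [cite: Balaban1983Higgs3, (1.21) p.416] -/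
theorem numSep_eq_zero_iff (hG : IsConnected G) :
    numSep G i j = 0 ↔ ∀ c : Leg G.kind, (G.other c).isSome → ReflTransGen (AdjOff G c) i j := by
  rw [numSep, card_eq_zero, eq_empty_iff_forall_notMem]
  constructor
  · intro h c hc
    by_contra hsep
    obtain ⟨c', hc'⟩ := Option.isSome_iff_exists.1 hc
    rcases (show Sep G i j c from ⟨hc, hsep⟩).isNear_or hG hc' with hn | hn
    · exact h c (mem_nearLegs.2 hn)
    · exact h c' (mem_nearLegs.2 hn)
  · intro h c hc
    have hn := mem_nearLegs.1 hc
    exact hn.1.2 (h c hn.1.1)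

/-- kernel: in a one-particle-irreducible graph no line separates anything — every pair of roots has `m = 0` (a 1PI
self-energy graph is a single insertion). [cite: Balaban1983Higgs3, (1.21) p.416] -/
theorem numSep_eq_zero_of_isOnePI (h : IsOnePI G) : numSep G i j = 0 :=
  (numSep_eq_zero_iff h.1).2 fun c hc => h.2 c hc i j

/-- **bridge to `B3OnePIGraphs.IsProper`**: a connected graph is proper (no internal line separates two external legs) iff
for every two external legs the number of lines separating their vertices is `0` — a proper self-energy insertion is a chain
with ONE piece. [cite: Balaban1983Higgs3, (1.21) p.416] -/
theorem isProper_iff_numSep_eq_zero (hG : IsConnected G) :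
    IsProper G ↔ ∀ x₁ x₂ : Leg G.kind, G.other x₁ = none → G.other x₂ = none → numSep G x₁.1 x₂.1 = 0 := by
  constructor
  · rintro ⟨_, h⟩ x₁ x₂ h₁ h₂
    exact (numSep_eq_zero_iff hG).2 fun c hc => h c hc x₁ x₂ h₁ h₂
  · intro h
    exact ⟨hG, fun c hc x₁ x₂ h₁ h₂ => (numSep_eq_zero_iff hG).1 (h x₁ x₂ h₁ h₂) c hc⟩

/-- **THE CHAIN DECOMPOSITION (summary)** of a connected graph of the model between two root vertices `i`, `j` — the
graph-theoretic structure print appeals to in (1.21), «G^ε = Σ_n C₀^ε[X C₀^ε]ⁿ» with X the (amputated) proper insertions: with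
`m = numSep G i j` separating lines and the level function `level G i j : vertices → {0,…,m}` (dictionary to p32 g41's
`B3Eq121OnePIChains.chainAmp C₀ amp [K₁,…,K_{m+1}] = C₀K₁C₀K₂…C₀K_{m+1}C₀`: the `m + 1` pieces `V_0,…,V_m` are the insertions, the
`m` separating lines are the INNER propagator lines `C₀`, the two outer `C₀` are the amputated external legs at `i` and `j`) —
(1) `i ∈ V_0`, `j ∈ V_m`, every `V_k` (`k ≤ m`) is non-empty; (2) for each `k < m` there is exactly one separating line
between `V_k` and `V_{k+1}` (near leg at level `k`, far leg at level `k+1`), every other internal line stays inside one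
piece, no line joins non-consecutive pieces; (3) each piece is connected through its own lines; (4) each piece is proper
between its ports.  Items (1)–(3) packaged; (4) is `proper_zero`/`proper_succ`/`proper_last`/`proper_none`.
[cite: Balaban1983Higgs3, (1.21) p.416] -/
theorem chain_decomposition (hG : IsConnected G) :
    level G i j i = 0 ∧ level G i j j = numSep G i j ∧
    (∀ k ≤ numSep G i j, ∃ v, level G i j v = k) ∧
    (∀ k < numSep G i j, ∃ c c' : Leg G.kind, G.other c = some c' ∧ IsNear G i j c ∧
        level G i j c.1 = k ∧ level G i j c'.1 = k + 1) ∧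
    (∀ c d : Leg G.kind, IsNear G i j c → IsNear G i j d → level G i j c.1 = level G i j d.1 → c = d) ∧
    (∀ x y : Leg G.kind, G.other x = some y → ¬ Sep G i j x → level G i j x.1 = level G i j y.1) ∧
    (∀ a b : Fin G.nV, Adj G a b →
        level G i j a = level G i j b ∨ level G i j b = level G i j a + 1 ∨ level G i j a = level G i j b + 1) ∧
    (∀ u v : Fin G.nV, level G i j u = level G i j v →
      ReflTransGen (fun a b => Adj G a b ∧ level G i j a = level G i j u ∧ level G i j b = level G i j u) u v) := by
  refine ⟨level_left, level_right, fun k hk => exists_level_eq hG hk, fun k hk => ?_,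
    fun c d hc hd h => hc.eq_of_level_eq hG hd h, fun x y hxy hx => level_eq_of_not_sep hxy hx,
    fun a b h => level_adj hG h, fun u v h => pieces_connected hG h⟩
  obtain ⟨c, hc, hck⟩ := exists_isNear_level_eq hG hk
  obtain ⟨c', hc'⟩ := hc.1.exists_other
  exact ⟨c, c', hc', hc, hck, by rw [hc.level_far hG hc', hck]⟩

end Literature.MathematicalPhysics.QuantumFieldTheory.Balaban1983to89.B3OnePIChainPieces
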